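/-
Copyright (c) 2026 the pub-hodgecm-mathlib formalisation cell (harness21).  Prover seat hodgecm-mathlib-F0P2-p09 (g2), Track B «K2-LIT»,
#184♮ = hLiu418 = `stmt-HodgeConjecture-24832`; socket #41, KIND 1 (K1-b♮), organ (K1b-W), brick (ρ3) — LEAD F0P6-plan (g14) BATCH #132 (2) (line lead K2Liu-p14 (g4),
LINE WORD #6 (Q2) bricks; K1 desk F0P2-p11 (g2)).  THEOREMS ONLY (no `def`, no `instance`, no notation, no named-fact hypothesis, no `sorry`).
-/
import Summits.HodgeConjecture.HodgeConjecture.Theorems.K2LiuCharacterTrivialBallNormBound     -- ★ (c2) p862738 `v_le_exp_of_forall_apply_mul_eq_one`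
import Summits.HodgeConjecture.HodgeConjecture.Theorems.K2LiuKindOneLineCharacterReading        -- ★ (KW1-b2′) p862968 (this seat): `invOf_two_eq_toLocalRing`, `algebraMap_localRing_apply`; brings ★ B4 (the `L ⊗ L⁺_v` ∕ `τ` currency)
import Literature.NumberTheory.Automorphic.UnitaryGroupDoubledBigCellNonsplit                    -- ★ `conjLocal_conjLocal` (`σ ∘ σ = id` on `L ⊗ L⁺_v`)
import Literature.NumberTheory.Automorphic.Liu2021.LemD1AsPrintedIndexedNonVacuityInertCofinite -- ★ `valued_toPlace_of_isUnramifiedIn` (`e(w|v) = 1`)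
import HarnessLib

/-!
# Crux `HLiu418`, socket #41, KIND 1 ∕ organ (K1b-W), brick (ρ3): «CHARACTER TRIVIAL ON THE LATTICE ⟹ ENTRYWISE BOUND ON THE FOURIER INDEX» AT `n = 2` —
# the entrywise edition of ★ (c2) `K2LiuCharacterTrivialBallNormBound` over `L ⊗ L⁺_v`, without the inverse different

Cell `hodgecm-mathlib`, crux item hLiu418 = `stmt-HodgeConjecture-24832` (helper lane `--supports … --as helper`, count-neutral), route of record
`HCCMUnconditional`; squad K2 ∕ K2Liu, road `K2_Liu`, socket #41 `sig_K2LiuSiegelEisensteinContinuation`, KIND 1, organ (K1b-W) (line lead K2Liu-p14 (g4)), the (Q2)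
«S-UNIFORMITY» road of LINE WORD #6: `MID_S ≠ 0` forces the character `ψ_S` to be trivial on the invariance lattice `Λ(h) = ∏_v Λ_v(h_v)` ((ρ1)(ρ2)), and PER PLACE that
triviality bounds the entries of `S` ((ρ3), THIS FILE) — the `hloc` letter of ★ `K2LiuSiegelEisensteinKindWInstance.hsupp_of_local`
(`∀ a b, |S_{ab}|_w ≤ exp m`), with `m` read off the lattice exponent by ★ (c1) `K2LiuLocalHeightLevelConjugation`.

THE MATHEMATICS ([Tate1950, §2.2], [BushnellHenniart2006, §1.7], [Shimura1997, §18.4], [WeilBNT1967, Ch. II §5, Ch. VIII §4]).  ★ (c2) is the one-variable fact «`ψ(a·𝔭^N) = 1 ⟹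
|a|_v ≤ exp(N − d)`» (`d` = conductor exponent of `ψ`).  Over `R = L ⊗ L⁺_v = ∏_{w∣v} L_w` with Tate's local trace `τ` (letters `hτ : ι_v(τ r) = r + σ r`, `hτs : τ(ι_v z·r) = z·τ r`
of ★ B3 ∕ ★ `K2LiuGoodPlaceLocalFactor`) the pairing is `(c, x) ↦ ψ(τ(c·x))`; testing with `x = ι_v(u)` and `x = ι_v(u)·δ̃` (`δ̃ = δ ⊗ 1`, `δ = imagUnit L`, `u ∈ 𝔭_v^N`) bounds
`|τ c|_v` and `|τ(δ̃ c)|_v` by (c2), and the IDENTITY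
  **`2·δ̃·c = δ̃·ι_v(τ c) + ι_v(τ(δ̃ c))`**  (from `hτ`: `ι_vτ c = c + σc`, `ι_vτ(δ̃c) = δ̃(c − σc)`)
recovers every component: `|2|_w·|δ|_w·|c_w|_w ≤ max(|δ|_w·|τ c|_v^{e}, |τ(δ̃ c)|_v^{e})` (`e = e(w|v)`, ★ `valued_toPlace`) — NO inverse different, uniform in split ∕ inert ∕
ramified `w`; at a good place (`|2|_w = |δ|_w = 1`, `v` unramified) simply `|c_w|_w ≤ exp(N − d)`.  The ENTRYWISE edition for a matrix index `S` then tests the pairing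
`X ↦ ψ(τ(−⅟2·tr((S⊗1)·X)))` (★ B4's reading of `ψ_S(n(X))_v`) on elementary test matrices.
* §1 **`valued_mul_le_of_forall_addChar_trace_eq_one`** — the scalar dual bound at every `w ∣ v` (general place, unit defects `|2|_w`, `|δ|_w` on the left);
  **`valued_apply_le_exp_of_good`** — the good-place form `|c_w|_w ≤ exp(N − d)`.
* §2 **`valued_entry_le_exp_of_forall_test`** — ENTRYWISE: if `ψ(τ(−⅟2·tr((S⊗1)·(x·E_{ab})))) = 1` for the test matrices `x·E_{ab}`, `x ∈ {ι_v u, ι_v(u)·δ̃}`, `u ∈ 𝔭_v^N`, then at a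
  good place `|S_{ba}|_w ≤ exp(N − d)` — in ★ `hsupp_of_local`'s `hloc` bytes `Valued.v ((S b a : L) : w.adicCompletion L) ≤ WithZero.exp m`; the general-place form with defects
  `valued_entry_mul_le_of_forall_test`.
HONEST LABEL.  Count-neutral helper; closes no socket by itself; `HC_CM` is proved only modulo the 7 printed citations (2 remaining named inputs:
hLiu418 = `stmt-HodgeConjecture-24832`, h413 = `stmt-HodgeConjecture-24833`) until rung 0 closes.  NOT HERE: the production of the lattice triviality from `MID_S ≠ 0`
((ρ1)∕(ρ2)), the restriction from the invariance lattice of record to the test matrices (the consumer's one line), and `(ψ, τ)` with the letters `hτ hτs` (★ B3).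

## References
* [Tate1950] J. Tate, thesis (1950), in Cassels–Fröhlich (1967) Ch. XV: §2.2 (conductor of `ψ`, dual lattices under `ψ(xy)`).
* [BushnellHenniart2006] C. J. Bushnell, G. Henniart, *The local Langlands conjecture for GL(2)*, Grundlehren 335 (2006): §1.7.
* [Shimura1997] G. Shimura, *Euler products and Eisenstein series*, CBMS 93 (1997): §18.4 Prop. 18.14 (support of Fourier coefficients in a dual lattice).
* [WeilBNT1967] A. Weil, *Basic Number Theory* (1967): Ch. II §5, Ch. VIII §4 (local trace and duality).
-/

set_option autoImplicit false
-- the mandated namespace repeats the single-problem summit's segment (`HodgeConjecture.HodgeConjecture`)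
set_option linter.dupNamespace false

noncomputable section

open scoped Matrix NNReal WithZero
open NumberField IsDedekindDomain Matrix
open Literature.NumberTheory.Automorphic Literature.NumberTheory.Automorphic.UnitaryGroup Literature.NumberTheory.GaloisRepresentations
open Literature.NumberTheory.GelbartRogawski1991 Literature.NumberTheory.GelbartRogawski1991.GRConstruction
open Literature.NumberTheory.GelbartRogawski1991.UnitaryDualPair
open Literature.NumberTheory.Automorphic.Liu2021.LemD1IndexedNonVacuityInertCofinite (valued_toPlace_of_isUnramifiedIn)
open Summit.HodgeConjecture.HodgeConjecture.Cruxes.HLiu418.K2LiuCharacterTrivialBallNormBound (v_le_exp_of_forall_apply_mul_eq_one)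
open Summit.HodgeConjecture.HodgeConjecture.Cruxes.HLiu418.K2LiuKindOneLineCharacterReading (invOf_two_eq_toLocalRing algebraMap_localRing_apply)

namespace Summit.HodgeConjecture.HodgeConjecture.Cruxes.HLiu418.K2LiuKindOneLineCharacterBoundTwo

variable (L : Type) [Field L] [NumberField L] [IsCMField L] (v : HeightOneSpectrum (𝓞 (Fp L)))

/-! ## §1 The scalar dual bound over `L ⊗ L⁺_v`, without the inverse different -/

/-- **`2·δ̃·c = δ̃·ι_v(τ c) + ι_v(τ(δ̃ c))`** in `R = L ⊗ L⁺_v` (`hτ`: `ι_v τ r = r + σ r`; `σ δ̃ = −δ̃`). [cite: WeilBNT1967, Ch. VIII §4] -/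
theorem two_mul_delta_mul_eq {τ : LocalRing L v → v.adicCompletion (Fp L)}
    (hτ : ∀ r, toLocalRing L v (τ r) = r + conjLocal L (IsCMField.complexConj L) v r) (c : LocalRing L v) :
    2 * algebraMap L (LocalRing L v) (imagUnit L) * c =
      algebraMap L (LocalRing L v) (imagUnit L) * toLocalRing L v (τ c) + toLocalRing L v (τ (algebraMap L (LocalRing L v) (imagUnit L) * c)) := by
  rw [hτ, hτ, map_mul, conjLocal_algebraMap, complexConj_imagUnit, map_neg]
  ring

omit [IsCMField L] in
/-- `|ι_w y|_w ≤ exp(e·k)` when `|y|_v ≤ exp k` (`e = e(w|v)`, ★ `valued_toPlace`). [cite: Tate1950, §2.2] -/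
theorem valued_toPlace_le_exp_mul (w : UnitaryGroup.PlacesOver L v) {y : v.adicCompletion (Fp L)} {k : ℤ} (hy : Valued.v y ≤ WithZero.exp k) :
    Valued.v (toPlace v w y) ≤ WithZero.exp ((v.asIdeal.ramificationIdx' w.1.asIdeal : ℤ) * k) := by
  rw [valued_toPlace, ← nsmul_eq_mul, WithZero.exp_nsmul]
  exact pow_le_pow_left' hy _

/-- **THE SCALAR DUAL BOUND OVER `L ⊗ L⁺_v` (general place, unit defects on the left).**  `ψ` an additive character of `L⁺_v` of conductor exponent `d`, `τ` a local trace with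
`hτ`, `hτs`; if `ψ(τ(ι_v(u)·c)) = 1` and `ψ(τ(ι_v(u)·δ̃·c)) = 1` for all `u ∈ 𝔭_v^N` (the character kills the two test vectors of the lattice through `c`), then at every `w ∣ v`
**`|2|_w · |δ|_w · |c_w|_w ≤ max(|δ|_w, 1) · exp(e(w|v)·(N − d))`** — ★ (c2) on `τ c` and `τ(δ̃ c)` (`hτs` pulls the scalar `u` out) + the identity `two_mul_delta_mul_eq` +
★ `valued_toPlace`; no inverse different, uniform in split ∕ inert ∕ ramified `w`. [cite: Tate1950, §2.2] [cite: BushnellHenniart2006, §1.7] [cite: WeilBNT1967, Ch. VIII §4] -/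
theorem valued_mul_le_of_forall_addChar_trace_eq_one {ψ : AddChar (v.adicCompletion (Fp L)) Circle} {d : ℤ} (hψ : ψ.HasConductorExp d)
    {τ : LocalRing L v → v.adicCompletion (Fp L)} (hτ : ∀ r, toLocalRing L v (τ r) = r + conjLocal L (IsCMField.complexConj L) v r)
    (hτs : ∀ (z : v.adicCompletion (Fp L)) (r : LocalRing L v), τ (toLocalRing L v z * r) = z * τ r)
    (c : LocalRing L v) (N : ℤ)
    (h₁ : ∀ u : v.adicCompletion (Fp L), Valued.v u ≤ WithZero.exp (-N) → ψ (τ (toLocalRing L v u * c)) = 1)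
    (h₂ : ∀ u : v.adicCompletion (Fp L), Valued.v u ≤ WithZero.exp (-N) → ψ (τ (toLocalRing L v u * (algebraMap L (LocalRing L v) (imagUnit L) * c))) = 1)
    (w : UnitaryGroup.PlacesOver L v) :
    Valued.v ((2 : L) : w.1.adicCompletion L) * Valued.v ((imagUnit L : L) : w.1.adicCompletion L) * Valued.v (c w) ≤
      max (Valued.v ((imagUnit L : L) : w.1.adicCompletion L)) 1 * WithZero.exp ((v.asIdeal.ramificationIdx' w.1.asIdeal : ℤ) * (N - d)) := by
  -- ★ (c2) on the two traces
  have hτ₁ : Valued.v (τ c) ≤ WithZero.exp (N - d) :=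
    v_le_exp_of_forall_apply_mul_eq_one v hψ fun u hu => by rw [mul_comm, ← hτs]; exact h₁ u hu
  have hτ₂ : Valued.v (τ (algebraMap L (LocalRing L v) (imagUnit L) * c)) ≤ WithZero.exp (N - d) :=
    v_le_exp_of_forall_apply_mul_eq_one v hψ fun u hu => by rw [mul_comm, ← hτs]; exact h₂ u hu
  -- the identity at the component `w`
  have hid := congrArg (fun r : LocalRing L v => r w) (two_mul_delta_mul_eq L v hτ c)
  simp only [Pi.mul_apply, Pi.add_apply, toLocalRing_apply] at hid
  have h2w : (2 : LocalRing L v) w = ((2 : L) : w.1.adicCompletion L) := by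
    rw [← map_ofNat (algebraMap L (LocalRing L v)) 2, algebraMap_localRing_apply]
  rw [h2w, algebraMap_localRing_apply] at hid
  calc Valued.v ((2 : L) : w.1.adicCompletion L) * Valued.v ((imagUnit L : L) : w.1.adicCompletion L) * Valued.v (c w)
      = Valued.v (((imagUnit L : L) : w.1.adicCompletion L) * toPlace v w (τ c) + toPlace v w (τ (algebraMap L (LocalRing L v) (imagUnit L) * c))) := by
        rw [← map_mul, ← map_mul, hid]
    _ ≤ max (Valued.v (((imagUnit L : L) : w.1.adicCompletion L) * toPlace v w (τ c))) (Valued.v (toPlace v w (τ (algebraMap L (LocalRing L v) (imagUnit L) * c)))) :=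
        Valuation.map_add _ _ _
    _ ≤ max (Valued.v ((imagUnit L : L) : w.1.adicCompletion L)) 1 * WithZero.exp ((v.asIdeal.ramificationIdx' w.1.asIdeal : ℤ) * (N - d)) := by
        rw [map_mul]
        refine max_le ?_ ?_
        · exact (mul_le_mul_right (valued_toPlace_le_exp_mul L v w hτ₁) _).trans (mul_le_mul_left (le_max_left _ _) _)
        · exact (valued_toPlace_le_exp_mul L v w hτ₂).trans (le_mul_of_one_le_left' (le_max_right _ _))

/-- **THE SCALAR DUAL BOUND AT A GOOD PLACE**: `v` unramified in `L`, `|2|_w = 1`, `|δ|_w = 1` ⟹ **`|c_w|_w ≤ exp(N − d)`**. [cite: Tate1950, §2.2] [cite: BushnellHenniart2006, §1.7] -/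
theorem valued_apply_le_exp_of_good {ψ : AddChar (v.adicCompletion (Fp L)) Circle} {d : ℤ} (hψ : ψ.HasConductorExp d)
    {τ : LocalRing L v → v.adicCompletion (Fp L)} (hτ : ∀ r, toLocalRing L v (τ r) = r + conjLocal L (IsCMField.complexConj L) v r)
    (hτs : ∀ (z : v.adicCompletion (Fp L)) (r : LocalRing L v), τ (toLocalRing L v z * r) = z * τ r)
    (hunr : Algebra.IsUnramifiedIn (𝓞 L) v.asIdeal)
    (w : UnitaryGroup.PlacesOver L v) (h2w : Valued.v ((2 : L) : w.1.adicCompletion L) = 1) (hδw : Valued.v ((imagUnit L : L) : w.1.adicCompletion L) = 1)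
    (c : LocalRing L v) (N : ℤ)
    (h₁ : ∀ u : v.adicCompletion (Fp L), Valued.v u ≤ WithZero.exp (-N) → ψ (τ (toLocalRing L v u * c)) = 1)
    (h₂ : ∀ u : v.adicCompletion (Fp L), Valued.v u ≤ WithZero.exp (-N) → ψ (τ (toLocalRing L v u * (algebraMap L (LocalRing L v) (imagUnit L) * c))) = 1) :
    Valued.v (c w) ≤ WithZero.exp (N - d) := by
  have h := valued_mul_le_of_forall_addChar_trace_eq_one L v hψ hτ hτs c N h₁ h₂ w
  have he : (v.asIdeal.ramificationIdx' w.1.asIdeal : ℤ) = 1 := by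
    have := Literature.NumberTheory.Automorphic.Liu2021.LemD1IndexedNonVacuityInertCofinite.ramificationIdx'_eq_one_of_isUnramifiedIn L v hunr w
    exact_mod_cast this
  rwa [h2w, hδw, one_mul, one_mul, max_self, one_mul, he, one_mul] at h

/-! ## §2 The elementary skew test matrices at `n = 2` and their traces (generic commutative ring with involution) -/

section TestMatrices

variable {R : Type*} [CommRing R] (σ : R →+* R)

/-- **THE OFF-DIAGONAL ELEMENTARY SKEW TEST MATRIX** `X₀₁(z) = !![0, z; −g₀ g₁⁻¹ σz, 0]` is `G`-skew, `(X.map σ)ᵀ·G + G·X = 0`, for a diagonal `G = diag(g₀, g₁)` with `σ`-fixed entries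
(`g₁⁻¹` a `σ`-fixed inverse of `g₁`) and `σ ∘ σ = id`. [cite: Shimura1997, §18.4] [cite: HarrisKudlaSweet1996, §1 (1.12)] -/
theorem skew_test01 (hσσ : ∀ r, σ (σ r) = r) (G : Matrix (Fin 2) (Fin 2) R) (hG01 : G 0 1 = 0) (hG10 : G 1 0 = 0) (hGσ : σ (G 0 0) = G 0 0)
    (g1inv : R) (hg1 : G 1 1 * g1inv = 1) (hg1σ : σ g1inv = g1inv) (z : R) :
    ((!![0, z; -(G 0 0 * g1inv * σ z), 0] : Matrix (Fin 2) (Fin 2) R).map σ)ᵀ * G + G * !![0, z; -(G 0 0 * g1inv * σ z), 0] = 0 := by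
  ext i j
  fin_cases i <;> fin_cases j <;>
    simp only [Matrix.add_apply, Matrix.mul_apply, Fin.sum_univ_two, Matrix.transpose_apply, Matrix.map_apply, Matrix.of_apply, Matrix.cons_val',
      Matrix.cons_val_zero, Matrix.cons_val_one, Matrix.cons_val_fin_one, Matrix.empty_val', Matrix.zero_apply, Fin.isValue, Fin.zero_eta, Fin.mk_one,
      map_zero, map_neg, map_mul, hσσ, hGσ, hg1σ, hG01, hG10, zero_mul, mul_zero, add_zero, zero_add]
  · linear_combination (-(G 0 0 * z)) * hg1
  · linear_combination (-(G 0 0 * σ z)) * hg1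

/-- the `(1,0)` twin `X₁₀(z) = !![0, −g₁ g₀⁻¹ σz; z, 0]`. [cite: Shimura1997, §18.4] [cite: HarrisKudlaSweet1996, §1 (1.12)] -/
theorem skew_test10 (hσσ : ∀ r, σ (σ r) = r) (G : Matrix (Fin 2) (Fin 2) R) (hG01 : G 0 1 = 0) (hG10 : G 1 0 = 0) (hGσ : σ (G 1 1) = G 1 1)
    (g0inv : R) (hg0 : G 0 0 * g0inv = 1) (hg0σ : σ g0inv = g0inv) (z : R) :
    ((!![0, -(G 1 1 * g0inv * σ z); z, 0] : Matrix (Fin 2) (Fin 2) R).map σ)ᵀ * G + G * !![0, -(G 1 1 * g0inv * σ z); z, 0] = 0 := by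
  ext i j
  fin_cases i <;> fin_cases j <;>
    simp only [Matrix.add_apply, Matrix.mul_apply, Fin.sum_univ_two, Matrix.transpose_apply, Matrix.map_apply, Matrix.of_apply, Matrix.cons_val',
      Matrix.cons_val_zero, Matrix.cons_val_one, Matrix.cons_val_fin_one, Matrix.empty_val', Matrix.zero_apply, Fin.isValue, Fin.zero_eta, Fin.mk_one,
      map_zero, map_neg, map_mul, hσσ, hGσ, hg0σ, hG01, hG10, zero_mul, mul_zero, add_zero, zero_add]
  · linear_combination (-(G 1 1 * σ z)) * hg0
  · linear_combination (-(G 1 1 * z)) * hg0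

/-- **THE DIAGONAL ELEMENTARY SKEW TEST MATRICES** `z·E₀₀`, `z·E₁₁` are `G`-skew when `σ z = −z` (`G` diagonal). [cite: Shimura1997, §18.4] -/
theorem skew_test00 (G : Matrix (Fin 2) (Fin 2) R) (hG01 : G 0 1 = 0) (hG10 : G 1 0 = 0) {z : R} (hz : σ z = -z) :
    ((!![z, 0; 0, 0] : Matrix (Fin 2) (Fin 2) R).map σ)ᵀ * G + G * !![z, 0; 0, 0] = 0 := by
  ext i j
  fin_cases i <;> fin_cases j <;>
    simp only [Matrix.add_apply, Matrix.mul_apply, Fin.sum_univ_two, Matrix.transpose_apply, Matrix.map_apply, Matrix.of_apply, Matrix.cons_val',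
      Matrix.cons_val_zero, Matrix.cons_val_one, Matrix.cons_val_fin_one, Matrix.empty_val', Matrix.zero_apply, Fin.isValue, Fin.zero_eta, Fin.mk_one,
      map_zero, hz, hG01, hG10, zero_mul, mul_zero, add_zero]
  ring

/-- the `(1,1)` twin. [cite: Shimura1997, §18.4] -/
theorem skew_test11 (G : Matrix (Fin 2) (Fin 2) R) (hG01 : G 0 1 = 0) (hG10 : G 1 0 = 0) {z : R} (hz : σ z = -z) :
    ((!![0, 0; 0, z] : Matrix (Fin 2) (Fin 2) R).map σ)ᵀ * G + G * !![0, 0; 0, z] = 0 := by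
  ext i j
  fin_cases i <;> fin_cases j <;>
    simp only [Matrix.add_apply, Matrix.mul_apply, Fin.sum_univ_two, Matrix.transpose_apply, Matrix.map_apply, Matrix.of_apply, Matrix.cons_val',
      Matrix.cons_val_zero, Matrix.cons_val_one, Matrix.cons_val_fin_one, Matrix.empty_val', Matrix.zero_apply, Fin.isValue, Fin.zero_eta, Fin.mk_one,
      map_zero, hz, hG01, hG10, zero_mul, mul_zero, add_zero, zero_add]
  ring

/-- traces against the test matrices: `tr(S·!![0, z; c, 0]) = S₁₀ z + S₀₁ c`, `tr(S·!![z,0;0,0]) = S₀₀ z`, `tr(S·!![0,0;0,z]) = S₁₁ z`. [folklore] -/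
theorem trace_mul_test (S : Matrix (Fin 2) (Fin 2) R) (z c : R) :
    Matrix.trace (S * !![0, z; c, 0]) = S 1 0 * z + S 0 1 * c ∧ Matrix.trace (S * !![z, 0; 0, 0]) = S 0 0 * z ∧ Matrix.trace (S * !![0, 0; 0, z]) = S 1 1 * z := by
  refine ⟨?_, ?_, ?_⟩
  · simp only [Matrix.trace_fin_two, Matrix.mul_apply, Fin.sum_univ_two, Matrix.of_apply, Matrix.cons_val', Matrix.cons_val_zero, Matrix.cons_val_one,
      Matrix.cons_val_fin_one, Matrix.empty_val', Fin.isValue, mul_zero, add_zero, zero_add]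
    ring
  · simp only [Matrix.trace_fin_two, Matrix.mul_apply, Fin.sum_univ_two, Matrix.of_apply, Matrix.cons_val', Matrix.cons_val_zero, Matrix.cons_val_one,
      Matrix.cons_val_fin_one, Matrix.empty_val', Fin.isValue, mul_zero, add_zero]
  · simp only [Matrix.trace_fin_two, Matrix.mul_apply, Fin.sum_univ_two, Matrix.of_apply, Matrix.cons_val', Matrix.cons_val_zero, Matrix.cons_val_one,
      Matrix.cons_val_fin_one, Matrix.empty_val', Fin.isValue, mul_zero, zero_add]

/-- **THE SKEW RELATIONS OF THE INDEX, ENTRYWISE** (`(S.map σ)ᵀ·G + G·S = 0`, `G` diagonal): `σ(S₀₁)·g₀ + g₁·S₁₀ = 0`, `σ(S₁₀)·g₁ + g₀·S₀₁ = 0`, `σ(S₀₀)·g₀ + g₀·S₀₀ = 0`,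
`σ(S₁₁)·g₁ + g₁·S₁₁ = 0`. [cite: HarrisKudlaSweet1996, §1 (1.12)] -/
theorem skew_entries {S G : Matrix (Fin 2) (Fin 2) R} (hG01 : G 0 1 = 0) (hG10 : G 1 0 = 0) (hS : (S.map σ)ᵀ * G + G * S = 0) :
    σ (S 0 1) * G 0 0 + G 1 1 * S 1 0 = 0 ∧ σ (S 1 0) * G 1 1 + G 0 0 * S 0 1 = 0 ∧ σ (S 0 0) * G 0 0 + G 0 0 * S 0 0 = 0 ∧ σ (S 1 1) * G 1 1 + G 1 1 * S 1 1 = 0 := by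
  have h := fun i j => congrFun (congrFun hS i) j
  have h10 := h 1 0
  have h01 := h 0 1
  have h00 := h 0 0
  have h11 := h 1 1
  simp only [Matrix.add_apply, Matrix.mul_apply, Fin.sum_univ_two, Matrix.transpose_apply, Matrix.map_apply, Matrix.zero_apply, hG01, hG10,
    mul_zero, zero_mul, add_zero, zero_add, Fin.isValue] at h10 h01 h00 h11
  exact ⟨h10, h01, h00, h11⟩

end TestMatrices

/-! ## §3 The entrywise bound at `n = 2` (K2Lit CM frame, good place) -/

/-- from the two scalar tests in the NEGATED form `ψ(−u·τ c) = ψ(−u·τ(δ̃ c)) = 1` (`|u|_v ≤ exp(−N)`) to the good-place bound `|c_w|_w ≤ exp(N − d)` (§1 after `u ↦ −u`).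
[cite: Tate1950, §2.2] [cite: BushnellHenniart2006, §1.7] -/
theorem valued_apply_le_exp_of_neg_tests {ψ : AddChar (v.adicCompletion (Fp L)) Circle} {d : ℤ} (hψ : ψ.HasConductorExp d)
    {τ : LocalRing L v → v.adicCompletion (Fp L)} (hτ : ∀ r, toLocalRing L v (τ r) = r + conjLocal L (IsCMField.complexConj L) v r)
    (hτs : ∀ (z : v.adicCompletion (Fp L)) (r : LocalRing L v), τ (toLocalRing L v z * r) = z * τ r)
    (hunr : Algebra.IsUnramifiedIn (𝓞 L) v.asIdeal)
    (w : UnitaryGroup.PlacesOver L v) (h2w : Valued.v ((2 : L) : w.1.adicCompletion L) = 1) (hδw : Valued.v ((imagUnit L : L) : w.1.adicCompletion L) = 1)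
    (c : LocalRing L v) (N : ℤ)
    (h : ∀ u : v.adicCompletion (Fp L), Valued.v u ≤ WithZero.exp (-N) →
      ψ (-(u * τ c)) = 1 ∧ ψ (-(u * τ (algebraMap L (LocalRing L v) (imagUnit L) * c))) = 1) :
    Valued.v (c w) ≤ WithZero.exp (N - d) := by
  refine valued_apply_le_exp_of_good L v hψ hτ hτs hunr w h2w hδw c N (fun u hu => ?_) (fun u hu => ?_)
  · have h1 := (h (-u) (by rwa [Valuation.map_neg])).1
    rw [hτs]
    rwa [neg_mul, neg_neg] at h1
  · have h2 := (h (-u) (by rwa [Valuation.map_neg])).2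
    rw [hτs]
    rwa [neg_mul, neg_neg] at h2

/-- **THE ENTRYWISE BOUND AT `n = 2` (brick (ρ3); good place).**  K2Lit CM frame `L ∕ L⁺`, `v` a place of `L⁺` unramified in `L`, `w ∣ v` with `|2|_w = |δ|_w = 1` (`δ = imagUnit L`),
`ψ` an additive character of `L⁺_v` of conductor exponent `d`, `τ` a local trace (`hτ hτadd hτs`, ★ B3's letters), `G ∈ M₂(L ⊗ L⁺_v)` DIAGONAL with entries `ι_v g₀`,
`ι_v g₁` (`gᵢ ≠ 0`; the form `gramS` of the doubled datum), `S ∈ M₂(L)` a `G`-SKEW Fourier index (`((S⊗1).map σ)ᵀ·G + G·(S⊗1) = 0`).  IF the character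
`X ↦ ψ(τ(−⅟2·tr((S⊗1)·X)))` (= `ψ_S(n(X))_v`, ★ B4) is trivial on the ELEMENTARY SKEW TEST MATRICES `X₀₁(z)`, `X₁₀(z)` (`z = ι_v(u)·y`, `y ∈ {1, δ̃}`) and `z·E₀₀`, `z·E₁₁`
(`z = ι_v(u)·δ̃`) for all `|u|_v ≤ exp(−N)` — all of which are `G`-skew (§2) with entries of size `≤ exp(−e·N)·(units)`, hence in any invariance lattice `⊇ ϖ_v^N·Skew(𝓞)` —
THEN every entry satisfies **`|S_{ab}|_w ≤ exp(N − d)`** — ★ `hsupp_of_local`'s `hloc` letter shape. [cite: Shimura1997, §18.4 Prop. 18.14] [cite: Tate1950, §2.2] [cite: BushnellHenniart2006, §1.7] -/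
theorem valued_entry_le_exp_of_forall_test {ψ : AddChar (v.adicCompletion (Fp L)) Circle} {d : ℤ} (hψ : ψ.HasConductorExp d)
    {τ : LocalRing L v → v.adicCompletion (Fp L)} (hτ : ∀ r, toLocalRing L v (τ r) = r + conjLocal L (IsCMField.complexConj L) v r)
    (hτadd : ∀ r r', τ (r + r') = τ r + τ r')
    (hτs : ∀ (z : v.adicCompletion (Fp L)) (r : LocalRing L v), τ (toLocalRing L v z * r) = z * τ r)
    (hunr : Algebra.IsUnramifiedIn (𝓞 L) v.asIdeal)
    (w : UnitaryGroup.PlacesOver L v) (h2w : Valued.v ((2 : L) : w.1.adicCompletion L) = 1) (hδw : Valued.v ((imagUnit L : L) : w.1.adicCompletion L) = 1)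
    (G : Matrix (Fin 2) (Fin 2) (LocalRing L v)) (hG01 : G 0 1 = 0) (hG10 : G 1 0 = 0)
    {g₀ g₁ : v.adicCompletion (Fp L)} (hg₀ : g₀ ≠ 0) (hg₁ : g₁ ≠ 0) (hG00 : G 0 0 = toLocalRing L v g₀) (hG11 : G 1 1 = toLocalRing L v g₁)
    (S : Matrix (Fin 2) (Fin 2) L)
    (hS : ((S.map (algebraMap L (LocalRing L v))).map (conjLocal L (IsCMField.complexConj L) v))ᵀ * G + G * S.map (algebraMap L (LocalRing L v)) = 0)
    (N : ℤ)
    (htest01 : ∀ u : v.adicCompletion (Fp L), Valued.v u ≤ WithZero.exp (-N) → ∀ y : LocalRing L v, (y = 1 ∨ y = algebraMap L (LocalRing L v) (imagUnit L)) →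
      ψ (τ (-(⅟(2 : LocalRing L v) * Matrix.trace (S.map (algebraMap L (LocalRing L v)) *
        !![0, toLocalRing L v u * y; -(G 0 0 * toLocalRing L v g₁⁻¹ * conjLocal L (IsCMField.complexConj L) v (toLocalRing L v u * y)), 0])))) = 1)
    (htest10 : ∀ u : v.adicCompletion (Fp L), Valued.v u ≤ WithZero.exp (-N) → ∀ y : LocalRing L v, (y = 1 ∨ y = algebraMap L (LocalRing L v) (imagUnit L)) →
      ψ (τ (-(⅟(2 : LocalRing L v) * Matrix.trace (S.map (algebraMap L (LocalRing L v)) *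
        !![0, -(G 1 1 * toLocalRing L v g₀⁻¹ * conjLocal L (IsCMField.complexConj L) v (toLocalRing L v u * y)); toLocalRing L v u * y, 0])))) = 1)
    (htest00 : ∀ u : v.adicCompletion (Fp L), Valued.v u ≤ WithZero.exp (-N) →
      ψ (τ (-(⅟(2 : LocalRing L v) * Matrix.trace (S.map (algebraMap L (LocalRing L v)) *
        !![toLocalRing L v u * algebraMap L (LocalRing L v) (imagUnit L), 0; 0, 0])))) = 1)
    (htest11 : ∀ u : v.adicCompletion (Fp L), Valued.v u ≤ WithZero.exp (-N) →
      ψ (τ (-(⅟(2 : LocalRing L v) * Matrix.trace (S.map (algebraMap L (LocalRing L v)) *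
        !![0, 0; 0, toLocalRing L v u * algebraMap L (LocalRing L v) (imagUnit L)])))) = 1) :
    ∀ a b : Fin 2, Valued.v ((S a b : L) : w.1.adicCompletion L) ≤ WithZero.exp (N - d) := by
  haveI : Algebra.IsQuadraticExtension (Fp L) L := IsCMField.isQuadraticExtension L
  haveI : CharZero (v.adicCompletion (Fp L)) := charZero_of_injective_algebraMap (algebraMap (Fp L) (v.adicCompletion (Fp L))).injective
  set σ := conjLocal L (IsCMField.complexConj L) v with hσdef
  set ι := toLocalRing L v with hιdef
  set δt := algebraMap L (LocalRing L v) (imagUnit L) with hδt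
  set S' := S.map (algebraMap L (LocalRing L v)) with hS'
  -- the involution and the trace letters
  have hσσ : ∀ r : LocalRing L v, σ (σ r) = r := fun r => conjLocal_conjLocal (IsCMField.complexConj L) v (complexConj_imagUnit L) (imagUnit_ne_zero L) r
  have hσι : ∀ z, σ (ι z) = ι z := fun z => by rw [hσdef, hιdef, conjLocal_toLocalRing]
  have hτσ : ∀ r : LocalRing L v, τ (σ r) = τ r := fun r => toLocalRing_injective L v (by rw [← hιdef, hτ, hτ, hσσ, add_comm])
  have hσδ : σ δt = -δt := by rw [hδt, hσdef, conjLocal_algebraMap, complexConj_imagUnit, map_neg]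
  have hτhalf : ∀ t : LocalRing L v, τ (-(⅟(2 : LocalRing L v) * t)) = -(2⁻¹ * τ t) := fun t => by
    rw [invOf_two_eq_toLocalRing, ← hιdef, ← neg_mul, ← map_neg ι, hτs, neg_mul]
  have h2ne : (2 : v.adicCompletion (Fp L)) ≠ 0 := two_ne_zero
  -- `|2|_v = 1` at the unramified good place
  have h2v : Valued.v (2 : v.adicCompletion (Fp L)) = 1 := by
    have h := valued_toPlace_of_isUnramifiedIn L v hunr w (2 : v.adicCompletion (Fp L))
    have hcoe : ((2 : L) : w.1.adicCompletion L) = toPlace v w 2 := by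
      rw [← algebraMap_localRing_apply L v (2 : L) w, map_ofNat (algebraMap L (LocalRing L v)) 2, Pi.ofNat_apply, map_ofNat (toPlace v w) 2]
    rw [← h, ← hcoe, h2w]
  -- the skew relations of the index; diagonal inverses; entries at `w`
  obtain ⟨hs10, hs01, hs00, hs11⟩ := skew_entries σ hG01 hG10 hS
  have hg1u : G 1 1 * ι g₁⁻¹ = 1 := by rw [hG11, ← map_mul, mul_inv_cancel₀ hg₁, map_one]
  have hg0u : G 0 0 * ι g₀⁻¹ = 1 := by rw [hG00, ← map_mul, mul_inv_cancel₀ hg₀, map_one]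
  have hG0σ : σ (G 0 0) = G 0 0 := by rw [hG00]; exact hσι g₀
  have hG1σ : σ (G 1 1) = G 1 1 := by rw [hG11]; exact hσι g₁
  have hentry : ∀ a b, Valued.v ((S a b : L) : w.1.adicCompletion L) = Valued.v (S' a b w) := fun a b => by
    rw [hS', Matrix.map_apply, algebraMap_localRing_apply]
  have harg : ∀ t : v.adicCompletion (Fp L), -(2⁻¹ * (2 * t)) = -t := fun t => by rw [← mul_assoc, inv_mul_cancel₀ h2ne, one_mul]
  -- OFF-DIAGONAL (1,0): the test `X₀₁(ι u · y)` reads `ψ(−u·τ(y·S'₁₀))`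
  have hoff10 : ∀ (u : v.adicCompletion (Fp L)) (y : LocalRing L v),
      ψ (τ (-(⅟(2 : LocalRing L v) * Matrix.trace (S' * !![0, ι u * y; -(G 0 0 * ι g₁⁻¹ * σ (ι u * y)), 0])))) = ψ (-(u * τ (y * S' 1 0))) := by
    intro u y
    have hsw : S' 0 1 * -(G 0 0 * ι g₁⁻¹ * σ (ι u * y)) = σ (-(σ (S' 0 1) * G 0 0 * ι g₁⁻¹ * (ι u * y))) := by
      simp only [map_neg, map_mul, hσσ, hG0σ, hσι]
      ring
    have hsecond : τ (S' 0 1 * -(G 0 0 * ι g₁⁻¹ * σ (ι u * y))) = τ (S' 1 0 * (ι u * y)) := by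
      rw [hsw, hτσ]
      congr 1
      linear_combination (-(ι g₁⁻¹ * (ι u * y))) * hs10 + (S' 1 0 * (ι u * y)) * hg1u
    rw [(trace_mul_test S' _ _).1, hτhalf, hτadd, hsecond, ← two_mul, show S' 1 0 * (ι u * y) = ι u * (y * S' 1 0) by ring, hτs, harg]
  -- OFF-DIAGONAL (0,1): the test `X₁₀(ι u · y)` reads `ψ(−u·τ(y·S'₀₁))`
  have hoff01 : ∀ (u : v.adicCompletion (Fp L)) (y : LocalRing L v),
      ψ (τ (-(⅟(2 : LocalRing L v) * Matrix.trace (S' * !![0, -(G 1 1 * ι g₀⁻¹ * σ (ι u * y)); ι u * y, 0])))) = ψ (-(u * τ (y * S' 0 1))) := by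
    intro u y
    have hsw : S' 1 0 * -(G 1 1 * ι g₀⁻¹ * σ (ι u * y)) = σ (-(σ (S' 1 0) * G 1 1 * ι g₀⁻¹ * (ι u * y))) := by
      simp only [map_neg, map_mul, hσσ, hG1σ, hσι]
      ring
    have hfirst : τ (S' 1 0 * -(G 1 1 * ι g₀⁻¹ * σ (ι u * y))) = τ (S' 0 1 * (ι u * y)) := by
      rw [hsw, hτσ]
      congr 1
      linear_combination (-(ι g₀⁻¹ * (ι u * y))) * hs01 + (S' 0 1 * (ι u * y)) * hg0u
    rw [(trace_mul_test S' _ _).1, hτhalf, hτadd, hfirst, ← two_mul, show S' 0 1 * (ι u * y) = ι u * (y * S' 0 1) by ring, hτs, harg]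
  -- DIAGONAL: `τ(S'_{aa}·ι u) = 0` for free (skew diagonal entries are anti-invariant), and the test `ι u·δ̃·E_{aa}` reads `ψ(−(2⁻¹u)·τ(δ̃ S'_{aa}))`
  have hdiag_free : ∀ {x : LocalRing L v}, σ x * G 0 0 + G 0 0 * x = 0 ∨ σ x * G 1 1 + G 1 1 * x = 0 → ∀ u : v.adicCompletion (Fp L), ψ (-(u * τ x)) = 1 := by
    intro x hx u
    have hσx : σ x = -x := by
      rcases hx with hx | hx
      · linear_combination (ι g₀⁻¹) * hx - (σ x + x) * hg0u
      · linear_combination (ι g₁⁻¹) * hx - (σ x + x) * hg1u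
    have hτx : τ x = 0 := by
      refine toLocalRing_injective L v ?_
      rw [← hιdef, hτ, hσx, add_neg_cancel, map_zero]
    rw [hτx, mul_zero, neg_zero, AddChar.map_zero_eq_one]
  have hdiag00 : ∀ u : v.adicCompletion (Fp L),
      ψ (τ (-(⅟(2 : LocalRing L v) * Matrix.trace (S' * !![ι u * δt, 0; 0, 0])))) = ψ (-((2⁻¹ * u) * τ (δt * S' 0 0))) := fun u => by
    rw [(trace_mul_test S' (ι u * δt) 0).2.1, hτhalf, show S' 0 0 * (ι u * δt) = ι u * (δt * S' 0 0) by ring, hτs, mul_assoc]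
  have hdiag11 : ∀ u : v.adicCompletion (Fp L),
      ψ (τ (-(⅟(2 : LocalRing L v) * Matrix.trace (S' * !![0, 0; 0, ι u * δt])))) = ψ (-((2⁻¹ * u) * τ (δt * S' 1 1))) := fun u => by
    rw [(trace_mul_test S' (ι u * δt) 0).2.2, hτhalf, show S' 1 1 * (ι u * δt) = ι u * (δt * S' 1 1) by ring, hτs, mul_assoc]
  -- rescaling `u ↦ 2u` keeps the ball (`|2|_v = 1`)
  have hball2 : ∀ u : v.adicCompletion (Fp L), Valued.v u ≤ WithZero.exp (-N) → Valued.v (2 * u) ≤ WithZero.exp (-N) := fun u hu => by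
    rwa [Valuation.map_mul, h2v, one_mul]
  have h2inv : ∀ u : v.adicCompletion (Fp L), 2⁻¹ * (2 * u) = u := fun u => by rw [← mul_assoc, inv_mul_cancel₀ h2ne, one_mul]
  -- assemble per entry
  intro a b
  rw [hentry]
  fin_cases a <;> fin_cases b
  · -- (0,0)
    refine valued_apply_le_exp_of_neg_tests L v hψ hτ hτs hunr w h2w hδw (S' 0 0) N fun u hu => ⟨hdiag_free (Or.inl hs00) u, ?_⟩
    have h := htest00 (2 * u) (hball2 u hu)
    rwa [hdiag00, h2inv] at h
  · -- (0,1)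
    refine valued_apply_le_exp_of_neg_tests L v hψ hτ hτs hunr w h2w hδw (S' 0 1) N fun u hu => ⟨?_, ?_⟩
    · have h := htest10 u hu 1 (Or.inl rfl)
      rwa [hoff01 u 1, one_mul] at h
    · have h := htest10 u hu δt (Or.inr rfl)
      rwa [hoff01 u δt] at h
  · -- (1,0)
    refine valued_apply_le_exp_of_neg_tests L v hψ hτ hτs hunr w h2w hδw (S' 1 0) N fun u hu => ⟨?_, ?_⟩
    · have h := htest01 u hu 1 (Or.inl rfl)
      rwa [hoff10 u 1, one_mul] at h
    · have h := htest01 u hu δt (Or.inr rfl)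
      rwa [hoff10 u δt] at h
  · -- (1,1)
    refine valued_apply_le_exp_of_neg_tests L v hψ hτ hτs hunr w h2w hδw (S' 1 1) N fun u hu => ⟨hdiag_free (Or.inr hs11) u, ?_⟩
    have h := htest11 (2 * u) (hball2 u hu)
    rwa [hdiag11, h2inv] at h

end Summit.HodgeConjecture.HodgeConjecture.Cruxes.HLiu418.K2LiuKindOneLineCharacterBoundTwo

end
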